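import Summits.QuantumAdvantage.QuantumAdvantage.Theses.SpinorFlattening
import Literature.Computability.QuantumComplexity.GaussianRank

/-!
# Disproof of `FlatteningBoundRobust` (stmt-QuantumAdvantage-1246) — standing adversary's work file

Crux (route SpinorFlattening, rank 3), restated 1:1 over the landed API of `GaussianRank.lean`
(`flatteningBoundRobust_iff` below is `Iff.rfl`):

  ∀ t K r, r · D_K(4t) < C(t,K) · 8^K →
    ∀ (a : Fin r → ℂ) (g : Fin r → QReg (4t) → ℂ), (∀ i, IsGaussian (g i)) →
      1 ≤ C(8t,K) · normSq (M^{⊗t} − Σ i, a i • g i),           D_K(N) = Σ_{j ≤ K, j ≡ K (2)} C(N,j).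

## Findings (cycle 1, refuter-cdisprove-stmt-QuantumAdvantage-1246-0, 2026-08-16)

VERDICT SO FAR: NO KILL.  The statement is (very probably) TRUE; it resists every cheap attack for a
structural reason recorded in §E.  What this file certifies (all `theorem`s below are sorry-free):

* §0  `flatteningBoundRobust_iff` — the inline `let`-vocabulary of the item IS the named API
      (`majorana`/`IsGaussian`/`magicMPow`/`flatteningDeficiency`), definitionally.
* §A  LOAD-BEARING HYPOTHESES ("any proof must use H"):
      - `flatteningBoundRobust_false_without_count`  : drop `r·D_K(4t) < C(t,K)·8^K` ⇒ false
        (t=1, r=2: |M⟩ = (|0000⟩+|1111⟩)/√2 is an exact 2-term Gaussian combination).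
      - `flatteningBoundRobust_false_with_le`        : weaken `<` to `≤` ⇒ false at (t,K,r)=(1,1,2):
        2·D_1(4) = 8 = C(1,1)·8 — the strict count is SHARP already at one copy.
      - `flatteningBoundRobust_false_without_gauss`  : drop `IsGaussian (g i)` ⇒ false (g = M itself).
      - `flatteningBoundRobust_false_without_linIndep`: drop `LinearIndependent ℂ A` inside the
        dictionary ⇒ false (A = 0 annihilates everything; every ψ ≠ 0 becomes "Gaussian").
* §B  NOT load-bearing: `ψ ≠ 0` inside the dictionary — `withoutNonzero_of_flatteningBoundRobust`
      (the crux implies its variant whose dictionary is `IsGaussian ∪ {0}`; zero terms are dropped).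
      Prover note: the deficiency bound rank F_K(g) ≤ D_K(4t) is trivial for g = 0, and for g ≠ 0 the
      n independent annihilators are AUTOMATICALLY isotropic ({c(v),c(w)} = 2(v·w)·1 applied to g),
      hence Lagrangian; no orbit description of Gaussian states is needed anywhere.
* §C  TIGHTNESS:
      - `flatteningBoundRobust_tight_r0` : at (t,K,r) = (1,0,0) the conclusion holds with EQUALITY
        (1 = C(8,0)·normSq M), so the constant `1` on the left is best possible uniformly.
      - `massBound_attained_t1` : at (t,K,r) = (1,1,1) there is a Gaussian g and a with
        normSq(M − a g) = 1/2 = 1 − r·D_1(4)/(C(1,1)·8): the natural STRENGTHENING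
        `1 − r·D_K(4t)/(C(t,K)8^K) ≤ normSq(M^t − φ)` (which follows from the landed
        `Theorems.SpinorFlattening.stub_massBound` once deficiency + orthonormality are formalised) is
        ATTAINED — no better constant than the Gaussian infidelity 1/2 of |M⟩ (CudbyStrelchuk2023 §6,
        DiasKoenig2024 §5) is possible at one copy; `not_better_than_massBound_t1`.
      - `not_without_binomial_factor_t1` : the factor C(8t,K) cannot be dropped (1 ≤ normSq fails).
      - `gaussian_decomposition_two_terms_t1` : the rank certificate is sharp at t = 1
        (count ⇒ r ≤ 1 is impossible, and r = 2 is attained: χ_G(M) = 2).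
      - `magicMPow_eq_sum_blockStrings` / `magicMPow_eq_sum_two_pow` : the exact 2^t-term Gaussian
        decomposition of M^{⊗t} (χ_G ≤ 2^t); `calibration_t2` (count admits r ≤ 2, excludes r = 3,
        4 terms suffice); `flatteningBoundRobust_imp_count_le_two_pow` : the crux FORCES the
        combinatorial inequality C(t,K)8^K ≤ 2^t·D_K(4t) — a cheap-falsity test it passes for all
        t ≤ 120 (equality only at (0,0), (1,1)) and asymptotically (exponent gap 1 − 0.3326).
* §D  COUNTEREXAMPLE SEARCHES (numerics, kit jobs; details in NOTES.md of the seat):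
      - j000106 (route review, 2026-08-15): CAR exact; deficiency rank F_K(g) = D_K(4t) EXACTLY for
        random Gaussians (t ≤ 3, K ≤ 3) — the deficiency count is sharp, so the hypothesis cannot be
        cheaply relaxed on the Gaussian side; all nonzero singular values of F_K(M^t) are ≥ 1.
      - j007894 (this seat, 2026-08-16, script cexsearch.py in the seat folder): Riemannian gradient
        search over r even Gaussian states for min normSq(M^t − Σ a_i g_i) at
        (t,r) ∈ {(1,1),(2,2),(2,3),(3,2),(3,3)} against (a) the crux bound 1/C(8t,K), (b) the
        mass-bound strengthening 1 − rD_K/(C(t,K)8^K) and (c) the full-rank Mirsky prediction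
        (ρ_K(t) − rD_K)/C(8t,K) from j000106's ranks ρ (t=2: 1/6 at r=2; t=3: 0.286 at r=2, 0.087 at
        r=3) — a residual below (c) would impugn the "all nonzero σ ≥ 1" numerics, below (a) the crux.
        STATUS at cycle-1 close: still QUEUED on the saturated farm (prio 79, ~1700 jobs ahead); its
        summary auto-attaches to the item; to be folded in here at the next re-arm.
      - combinatorial sweep (this seat, exact integer arithmetic): C(t,K)8^K ≤ 2^t·D_K(4t) for all
        t ≤ 120 (equality only at (0,0),(1,1)); certificate max_K ⌈C(t,K)8^K/D_K(4t)⌉ for t = 1..12: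
        2,3,3,4,5,6,7,9,11,15,18,23 (vs the trivial upper bound 2^t) — consistent, no kill.
* GENERATION 2 (refuter-cdisprove-stmt-QuantumAdvantage-1246-g2-0, 2026-08-16) — still NO KILL; added:
  §G  DICTIONARY RIGIDITY (no "fake Gaussian" counterexample family exists): `linComb_anticomm`
      (bilinear CAR `c(v)c(w)+c(w)c(v) = 2(v·w)1`), `annihilators_orthogonal` /
      `annihilatorFamily_isotropic` (annihilators of ANY ψ ≠ 0 are pairwise isotropic),
      `card_annihilators_le` (at most `n` independent annihilators — isotropic subspaces of the
      non-degenerate form `v·w` on ℂ^{2n} have dim ≤ n; Mathlib `BilinForm.finrank_add_finrank_orthogonal`),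
      `no_overcomplete_annihilators` (the dictionary with `n+1` annihilators is EMPTY: a crux typed
      with `Fin (n+1)` would be vacuous; with `Fin n` it is exactly the pure-spinor dictionary).
  §H  TIGHTNESS AT EVERY t: `normSq_magicMPow` (‖M^{⊗t}‖² = 1), `flatteningBoundRobust_tight_K0`
      (equality at (t,0,0) for all t — the constant 1 cannot improve at any number of copies),
      `robust_slice_r0` (the r = 0 slice holds outright: a counterexample needs r ≥ 1, hence K ≥ 1).
  §A5 `flatteningBoundRobust_false_with_deficiency_pred`: D_K(4t) − 1 in the count admits (1,1,2) ⇒ false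
      (the deficiency constant is sharp, matching j000106's rank F_K(g) = D_K(4t) exactly).
  §J  HOW MANY ANNIHILATORS ARE LOAD-BEARING: `flatteningBoundRobust_false_with_four_fewer_annihilators`
      — with `n − 4` annihilators per term the crux fails at (2,2,2): M⊗M = (√2)⁻¹(ψ₀ + ψ₁),
      ψ_c = |cccc⟩ ⊗ |M⟩ each carrying the 4 one-mode annihilators of block 0 (`modeAnnihilator_basisState`,
      a reusable lemma: (c_{k,X} + i(−1)^{x_k} c_{k,Y})|x⟩ = 0).  Informally n − 3 suffice modulo the crux
      (half-spinors in ≤ 3 modes are all pure, so the parity parts of an (n−k)-annihilated vector, k ≤ 3,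
      are Gaussian) — the obstruction is local to ONE magic block.
  §D  numerics g2: kit j009669 (gdist/main.py: min normSq(M^t − span of r Gaussians) by L-BFGS over
      Pfaffian charts; t = 2: r = 1..3, t = 3: r = 1..4; read against crux 1/C(8t,K), mass bound
      1 − rD_K/(C(t,K)8^K) and the naive 1 − r·2^{-t}) — queued on the saturated farm at publication.
  Sibling context: crux 1245's picked line `spectral-mass-flattening` makes 1246 a corollary
  (ideator file `Transfer.lean`: FlatteningBoundBessel → FlatteningBoundRobust); its five stubs
  (normalOrder, filterCard, flatOrthoOfInvariant, magicInvariant, countGap) were re-read here and are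
  TRUE as typed (JW tails: later-block Majoranas put Z⊗4 on earlier blocks, sign (−1)^4 = +1 against X⊗4).
* §F  BY-PRODUCT for provers: `choose_mul_eight_pow_le` (C(t,K)8^K ≤ C(8t,K)), the step from the
      mass-bound form of the inequality to the crux's binomial factor.
* §E  WHY IT RESISTS (the three-line proof every reviewer re-derived; recorded so nobody repeats the
      attack): F_K(ψ) : e_S ↦ c_S ψ (|S| = K).  (i) rank F_K(g) ≤ D_K(4t) for Gaussian g (normal
      ordering into Λ^{≤K, ≡K} of a Witt complement of the annihilator Lagrangian); linearity ⇒
      rank F_K(φ) ≤ r·D_K(4t) for an r-term φ.  (ii) the C(t,K)·8^K one-Majorana-per-block images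
      c_S M^{⊗t} are ORTHONORMAL (covariance matrix of GHZ₄ vanishes; Z^{⊗4}M = M; ⟨M|c_a|M⟩ = 0), so
      F_K(M^t) is an isometry on their span V.  (iii) dim V > rank F_K(φ) ⇒ ∃ unit v ∈ V ∩ ker F_K(φ),
      1 = ‖F_K(M^t − φ) v‖² ≤ ‖F_K(M^t − φ)‖_F² = C(8t,K)·normSq(M^t − φ) (each c_S unitary).
      No step has slack that a small model could exploit: (i) is an identity of dimensions (sharp by
      j000106), (ii) is an exact stabiliser computation, (iii) is Bessel.  The only junk-prone
      ingredients (ℕ-subtraction, division, `choose` out of range) are absent or harmless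
      (K > t ⇒ hypothesis `r·D < 0` is false; r = 0 ⇒ 1 ≤ C(8t,K)·1).
-/

noncomputable section

set_option linter.dupNamespace false

namespace Summit.QuantumAdvantage.QuantumAdvantage.Cruxes.FlatteningBoundRobust.Disproof

open Matrix Finset
open Literature.Computability.QuantumComplexity Literature.Computability.Cryptography
open Summit.QuantumAdvantage.QuantumAdvantage.Theses.SpinorFlattening (FlatteningBoundRobust)

/-! ## §0 The crux over the named API -/

/-- The crux, restated verbatim over `GaussianRank.lean`'s named declarations. -/
def Robust : Prop :=
  ∀ t K r : ℕ, r * flatteningDeficiency K (t * 4) < t.choose K * 8 ^ K →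
    ∀ (a : Fin r → ℂ) (g : Fin r → QReg (t * 4) → ℂ), (∀ i, IsGaussian (g i)) →
      (1 : ℝ) ≤ ((t * 8).choose K : ℝ) * normSq (magicMPow t - ∑ i, a i • g i)

/-- The item's inline `let`-vocabulary is definitionally the named API. -/
theorem flatteningBoundRobust_iff : FlatteningBoundRobust ↔ Robust := Iff.rfl

/-! ## Small facts about `|M⟩` used by the witnesses -/

/-- `normSq 0 = 0`. -/
theorem normSq_zero' (n : ℕ) : normSq (0 : QReg n → ℂ) = 0 := by
  simp [normSq]

/-- `normSq (c • |x⟩) = ‖c‖²`. -/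
theorem normSq_smul_basisState {n : ℕ} (c : ℂ) (x : QReg n) :
    normSq (c • basisState x) = ‖c‖ ^ 2 := by
  unfold normSq
  rw [Finset.sum_eq_single x]
  · simp [basisState_apply]
  · intro y _ hy
    simp [basisState_apply, hy]
  · simp

/-- `|M⟩^{⊗1} = |M⟩` as functions. -/
theorem magicMPow_one' : magicMPow 1 = magicM := funext magicMPow_one

/-- `|M⟩ ≠ 0`. -/
theorem magicM_ne_zero : magicM ≠ 0 := by
  intro h
  have h1 := normSq_magicM
  rw [h, normSq_zero'] at h1
  exact zero_ne_one h1

/-- `|M⟩^{⊗1} ≠ 0`. -/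
theorem magicMPow_one_ne_zero : magicMPow 1 ≠ 0 := by
  rw [magicMPow_one']
  exact magicM_ne_zero

/-- The 2-term witness: coefficients `(√2)⁻¹, (√2)⁻¹`. -/
def aW : Fin 2 → ℂ := ![(Real.sqrt 2 : ℂ)⁻¹, (Real.sqrt 2 : ℂ)⁻¹]

/-- The 2-term witness: the Gaussian (computational-basis) states `|0000⟩, |1111⟩`. -/
def gW : Fin 2 → QReg (1 * 4) → ℂ := ![basisState (fun _ => false), basisState (fun _ => true)]

/-- Both witness states are Gaussian. -/
theorem gW_isGaussian : ∀ i, IsGaussian (gW i) := by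
  intro i
  fin_cases i
  · exact basisState_isGaussian _
  · exact basisState_isGaussian _

/-- `|M⟩ = (√2)⁻¹ |0000⟩ + (√2)⁻¹ |1111⟩` — an exact 2-term Gaussian decomposition of `|M⟩^{⊗1}`. -/
theorem sum_aW_gW : ∑ i, aW i • gW i = magicMPow 1 := by
  rw [magicMPow_one', Fin.sum_univ_two]
  simp only [aW, gW, Matrix.cons_val_zero, Matrix.cons_val_one, magicM, smul_add]

/-- The 1-term witness `(√2)⁻¹ |0000⟩` leaves the residual `(√2)⁻¹ |1111⟩`. -/
theorem magicMPow_one_sub_half_vacuum :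
    magicMPow 1 - (Real.sqrt 2 : ℂ)⁻¹ • (basisState (fun _ => false) : QReg (1 * 4) → ℂ) =
      (Real.sqrt 2 : ℂ)⁻¹ • basisState (fun _ => true) := by
  rw [magicMPow_one']
  simp only [magicM, smul_add]
  abel

/-- `‖(√2)⁻¹‖² = 1/2` in `ℂ`. -/
theorem norm_inv_sqrt_two_sq : ‖(Real.sqrt 2 : ℂ)⁻¹‖ ^ 2 = 1 / 2 := by
  rw [norm_inv, Complex.norm_real, Real.norm_of_nonneg (Real.sqrt_nonneg 2), inv_pow,
    Real.sq_sqrt (by norm_num : (0 : ℝ) ≤ 2)]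
  norm_num

/-! ## §A Load-bearing hypotheses -/

/-- The crux with the flattening count `r · D_K(4t) < C(t,K) · 8^K` DROPPED. -/
def WithoutCount : Prop :=
  ∀ t K r : ℕ, ∀ (a : Fin r → ℂ) (g : Fin r → QReg (t * 4) → ℂ), (∀ i, IsGaussian (g i)) →
    (1 : ℝ) ≤ ((t * 8).choose K : ℝ) * normSq (magicMPow t - ∑ i, a i • g i)

/-- Any proof must use the count: without it, `(t,K,r) = (1,1,2)` with `|M⟩ = (|0000⟩+|1111⟩)/√2`
(two Gaussian terms, residual 0) violates `1 ≤ 8 · 0`. -/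
theorem flatteningBoundRobust_false_without_count : ¬ WithoutCount := by
  intro h
  have key := h 1 1 2 aW gW gW_isGaussian
  rw [sum_aW_gW, sub_self, normSq_zero', mul_zero] at key
  exact absurd key (by norm_num)

/-- The crux with the STRICT count weakened to `≤`. -/
def WithLe : Prop :=
  ∀ t K r : ℕ, r * flatteningDeficiency K (t * 4) ≤ t.choose K * 8 ^ K →
    ∀ (a : Fin r → ℂ) (g : Fin r → QReg (t * 4) → ℂ), (∀ i, IsGaussian (g i)) →
      (1 : ℝ) ≤ ((t * 8).choose K : ℝ) * normSq (magicMPow t - ∑ i, a i • g i)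

/-- The strict inequality in the count is SHARP: at `(t,K,r) = (1,1,2)` one has
`2 · D_1(4) = 8 = C(1,1) · 8` and the 2-term decomposition of `|M⟩` has residual `0`. -/
theorem flatteningBoundRobust_false_with_le : ¬ WithLe := by
  intro h
  have hcount : 2 * flatteningDeficiency 1 (1 * 4) ≤ Nat.choose 1 1 * 8 ^ 1 := by decide
  have key := h 1 1 2 hcount aW gW gW_isGaussian
  rw [sum_aW_gW, sub_self, normSq_zero', mul_zero] at key
  exact absurd key (by norm_num)

/-- The crux with the dictionary constraint `IsGaussian (g i)` DROPPED. -/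
def WithoutGauss : Prop :=
  ∀ t K r : ℕ, r * flatteningDeficiency K (t * 4) < t.choose K * 8 ^ K →
    ∀ (a : Fin r → ℂ) (g : Fin r → QReg (t * 4) → ℂ),
      (1 : ℝ) ≤ ((t * 8).choose K : ℝ) * normSq (magicMPow t - ∑ i, a i • g i)

/-- Any proof must use Gaussianity: `(t,K,r) = (1,1,1)` satisfies the count (`1·4 < 8`) and
`g = |M⟩` itself has residual `0`. -/
theorem flatteningBoundRobust_false_without_gauss : ¬ WithoutGauss := by
  intro h
  have hcount : 1 * flatteningDeficiency 1 (1 * 4) < Nat.choose 1 1 * 8 ^ 1 := by decide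
  have key := h 1 1 1 hcount ![1] ![magicMPow 1]
  have hsum : ∑ i, (![(1 : ℂ)] i) • (![magicMPow 1] i) = magicMPow 1 := by
    rw [Fin.sum_univ_one]
    simp
  rw [hsum, sub_self, normSq_zero', mul_zero] at key
  exact absurd key (by norm_num)

/-- The dictionary with `LinearIndependent ℂ A` DROPPED (any `n` annihilating combinations, possibly
all zero). -/
def IsGaussianNoLI {n : ℕ} (ψ : QReg n → ℂ) : Prop :=
  ψ ≠ 0 ∧ ∃ A : Fin n → (Fin n × Bool → ℂ), ∀ k, (∑ p : Fin n × Bool, A k p • majorana n p.1 p.2) *ᵥ ψ = 0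

/-- Without linear independence every nonzero vector is in the dictionary (`A = 0`). -/
theorem isGaussianNoLI_of_ne_zero {n : ℕ} {ψ : QReg n → ℂ} (h : ψ ≠ 0) : IsGaussianNoLI ψ :=
  ⟨h, fun _ _ => 0, fun k => by simp⟩

/-- The crux over the dictionary without linear independence. -/
def WithoutLinIndep : Prop :=
  ∀ t K r : ℕ, r * flatteningDeficiency K (t * 4) < t.choose K * 8 ^ K →
    ∀ (a : Fin r → ℂ) (g : Fin r → QReg (t * 4) → ℂ), (∀ i, IsGaussianNoLI (g i)) →
      (1 : ℝ) ≤ ((t * 8).choose K : ℝ) * normSq (magicMPow t - ∑ i, a i • g i)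

/-- Any proof must use the linear independence of the `n = 4t` annihilators (it is what makes the
annihilator space Lagrangian and the deficiency count `D_K(4t)` valid): with `A = 0` the state `|M⟩`
itself is in the weakened dictionary. -/
theorem flatteningBoundRobust_false_without_linIndep : ¬ WithoutLinIndep := by
  intro h
  have hcount : 1 * flatteningDeficiency 1 (1 * 4) < Nat.choose 1 1 * 8 ^ 1 := by decide
  have key := h 1 1 1 hcount ![1] ![magicMPow 1]
    (fun i => by fin_cases i; exact isGaussianNoLI_of_ne_zero magicMPow_one_ne_zero)
  have hsum : ∑ i, (![(1 : ℂ)] i) • (![magicMPow 1] i) = magicMPow 1 := by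
    rw [Fin.sum_univ_one]
    simp
  rw [hsum, sub_self, normSq_zero', mul_zero] at key
  exact absurd key (by norm_num)

/-! ## §B A hypothesis that is NOT load-bearing: `ψ ≠ 0` in the dictionary -/

/-- The dictionary with `ψ ≠ 0` DROPPED: `IsGaussian ∪ {0}`. -/
def IsGaussianOrZero {n : ℕ} (ψ : QReg n → ℂ) : Prop :=
  ∃ A : Fin n → (Fin n × Bool → ℂ), LinearIndependent ℂ A ∧
    ∀ k, (∑ p : Fin n × Bool, A k p • majorana n p.1 p.2) *ᵥ ψ = 0

/-- A member of the weakened dictionary is `0` or Gaussian. -/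
theorem isGaussianOrZero_iff {n : ℕ} (ψ : QReg n → ℂ) :
    IsGaussianOrZero ψ ↔ ψ = 0 ∨ IsGaussian ψ := by
  constructor
  · intro h
    by_cases hψ : ψ = 0
    · exact Or.inl hψ
    · exact Or.inr ⟨hψ, h⟩
  · rintro (rfl | h)
    · obtain ⟨_, A, hA, _⟩ := zeroState_isGaussian n
      exact ⟨A, hA, fun k => Matrix.mulVec_zero _⟩
    · exact h.2

/-- The crux over the dictionary `IsGaussian ∪ {0}`. -/
def WithoutNonzero : Prop :=
  ∀ t K r : ℕ, r * flatteningDeficiency K (t * 4) < t.choose K * 8 ^ K →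
    ∀ (a : Fin r → ℂ) (g : Fin r → QReg (t * 4) → ℂ), (∀ i, IsGaussianOrZero (g i)) →
      (1 : ℝ) ≤ ((t * 8).choose K : ℝ) * normSq (magicMPow t - ∑ i, a i • g i)

/-- `ψ ≠ 0` is NOT load-bearing: the crux implies its `IsGaussian ∪ {0}` variant (replace every zero
term by the vacuum with coefficient `0`; the count hypothesis is untouched). -/
theorem withoutNonzero_of_flatteningBoundRobust (h : FlatteningBoundRobust) : WithoutNonzero := by
  classical
  rw [flatteningBoundRobust_iff] at h
  intro t K r hcount a g hg
  let g' : Fin r → QReg (t * 4) → ℂ := fun i => if g i = 0 then zeroState (t * 4) else g i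
  let a' : Fin r → ℂ := fun i => if g i = 0 then 0 else a i
  have hg' : ∀ i, IsGaussian (g' i) := by
    intro i
    by_cases hi : g i = 0
    · simp only [g', if_pos hi]
      exact zeroState_isGaussian _
    · simp only [g', if_neg hi]
      exact ((isGaussianOrZero_iff _).1 (hg i)).resolve_left hi
  have hsum : ∑ i, a' i • g' i = ∑ i, a i • g i := by
    refine Finset.sum_congr rfl fun i _ => ?_
    by_cases hi : g i = 0
    · simp only [a', g', if_pos hi, zero_smul, hi, smul_zero]
    · simp only [a', g', if_neg hi]
  have := h t K r hcount a' g' hg'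
  rwa [hsum] at this

/-! ## §C Tightness -/

/-- The conclusion's constant `1` is attained: at `(t,K,r) = (1,0,0)` (count `0 < 1`),
`C(8,0) · normSq (|M⟩ − 0) = 1`. -/
theorem flatteningBoundRobust_tight_r0 (a : Fin 0 → ℂ) (g : Fin 0 → QReg (1 * 4) → ℂ) :
    ((1 * 8).choose 0 : ℝ) * normSq (magicMPow 1 - ∑ i, a i • g i) = 1 := by
  rw [Finset.univ_eq_empty, Finset.sum_empty, sub_zero, magicMPow_one', normSq_magicM]
  norm_num

/-- The mass-bound strengthening is ATTAINED at one copy: `g = |0000⟩`, `a = (√2)⁻¹` gives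
`normSq (|M⟩ − a g) = 1/2 = 1 − r·D_1(4)/(C(1,1)·8)` with `r = 1`. (Gaussian infidelity of `|M⟩`.) -/
theorem massBound_attained_t1 :
    ∃ (a : Fin 1 → ℂ) (g : Fin 1 → QReg (1 * 4) → ℂ), (∀ i, IsGaussian (g i)) ∧
      normSq (magicMPow 1 - ∑ i, a i • g i) = 1 / 2 := by
  refine ⟨![(Real.sqrt 2 : ℂ)⁻¹], ![basisState (fun _ => false)], ?_, ?_⟩
  · intro i
    fin_cases i
    exact basisState_isGaussian _
  · rw [Fin.sum_univ_one, Matrix.cons_val_fin_one, Matrix.cons_val_fin_one,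
      magicMPow_one_sub_half_vacuum, normSq_smul_basisState, norm_inv_sqrt_two_sq]

/-- Hence NO constant better than the mass bound `1 − r·D_K(4t)/(C(t,K)8^K)` (= 1/2 here) holds at
`(t,K,r) = (1,1,1)`: the natural strengthening of the crux is sharp at one copy. -/
theorem not_better_than_massBound_t1 :
    ¬ ∃ ε : ℝ, 0 < ε ∧ ∀ (a : Fin 1 → ℂ) (g : Fin 1 → QReg (1 * 4) → ℂ), (∀ i, IsGaussian (g i)) →
      1 - (1 * (4 : ℝ)) / 8 + ε ≤ normSq (magicMPow 1 - ∑ i, a i • g i) := by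
  rintro ⟨ε, hε, h⟩
  obtain ⟨a, g, hg, hval⟩ := massBound_attained_t1
  have := h a g hg
  rw [hval] at this
  linarith

/-- The binomial factor `C(8t,K)` cannot be dropped from the conclusion: `1 ≤ normSq (|M⟩ − a g)`
fails for the half-vacuum witness (residual `1/2`). -/
theorem not_without_binomial_factor_t1 :
    ¬ ∀ (a : Fin 1 → ℂ) (g : Fin 1 → QReg (1 * 4) → ℂ), (∀ i, IsGaussian (g i)) →
      (1 : ℝ) ≤ normSq (magicMPow 1 - ∑ i, a i • g i) := by
  intro h
  obtain ⟨a, g, hg, hval⟩ := massBound_attained_t1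
  have := h a g hg
  rw [hval] at this
  norm_num at this

/-- The rank certificate is sharp at `t = 1`: the count excludes `r ≤ 1` for `K = 1`
(`1·D_1(4) = 4 < 8`), and `r = 2` Gaussian terms DO reach `|M⟩` exactly (`χ_G(|M⟩) = 2`). -/
theorem gaussian_decomposition_two_terms_t1 :
    (1 * flatteningDeficiency 1 (1 * 4) < Nat.choose 1 1 * 8 ^ 1) ∧
    ∃ (a : Fin 2 → ℂ) (g : Fin 2 → QReg (1 * 4) → ℂ), (∀ i, IsGaussian (g i)) ∧
      magicMPow 1 = ∑ i, a i • g i :=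
  ⟨by decide, aW, gW, gW_isGaussian, sum_aW_gW.symm⟩

/-- EXACT `2^t`-TERM GAUSSIAN DECOMPOSITION (block strings): `|M⟩^{⊗t} = (√2)^{-t} Σ_{b : Fin t → Bool} |b₀⁴ b₁⁴ ⋯⟩`
— every block-constant basis string is Gaussian, so `χ_G(M^{⊗t}) ≤ 2^t` (CudbyStrelchuk2023 §6, trivial
upper bound).  The certificate of the crux must stay below this for every `t`; see
`flatteningBoundRobust_imp_count_le_two_pow`. -/
theorem magicMPow_eq_sum_blockStrings (t : ℕ) :
    magicMPow t = ∑ b : Fin t → Bool, (((Real.sqrt 2 : ℂ)⁻¹) ^ t) •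
      basisState (fun w : Fin (t * 4) => b (finProdFinEquiv.symm w).1) := by
  classical
  funext x
  simp only [Finset.sum_apply, Pi.smul_apply, basisState_apply, smul_eq_mul, mul_ite, mul_one,
    mul_zero]
  by_cases hP : ∀ k : Fin t, ∀ i : Fin 4,
      x (finProdFinEquiv (k, i)) = x (finProdFinEquiv (k, (0 : Fin 4)))
  · rw [magicMPow_apply, if_pos hP]
    rw [Finset.sum_eq_single (fun k => x (finProdFinEquiv (k, (0 : Fin 4))))]
    · rw [if_pos]
      funext w
      obtain ⟨⟨k, i⟩, rfl⟩ := finProdFinEquiv.surjective w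
      simp only [Equiv.symm_apply_apply]
      exact hP k i
    · intro b _ hb
      rw [if_neg]
      intro hx
      apply hb
      funext k
      have := congrFun hx (finProdFinEquiv (k, (0 : Fin 4)))
      simp only [Equiv.symm_apply_apply] at this
      exact this.symm
    · intro h
      exact absurd (Finset.mem_univ _) h
  · rw [magicMPow_apply, if_neg hP]
    symm
    apply Finset.sum_eq_zero
    intro b _
    rw [if_neg]
    intro hx
    apply hP
    intro k i
    rw [hx]
    simp only [Equiv.symm_apply_apply]

/-- The `2^t`-term decomposition in the crux's own shape (indexed by `Fin (2^t)`). -/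
theorem magicMPow_eq_sum_two_pow (t : ℕ) :
    ∃ (a : Fin (2 ^ t) → ℂ) (g : Fin (2 ^ t) → QReg (t * 4) → ℂ), (∀ i, IsGaussian (g i)) ∧
      magicMPow t = ∑ i, a i • g i := by
  classical
  have hcard : Fintype.card (Fin t → Bool) = 2 ^ t := by simp
  let e : (Fin t → Bool) ≃ Fin (2 ^ t) := Fintype.equivFinOfCardEq hcard
  refine ⟨fun _ => ((Real.sqrt 2 : ℂ)⁻¹) ^ t,
    fun i => basisState (fun w : Fin (t * 4) => (e.symm i) (finProdFinEquiv.symm w).1),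
    fun i => basisState_isGaussian _, ?_⟩
  rw [magicMPow_eq_sum_blockStrings]
  exact (Equiv.sum_comp e.symm (fun b : Fin t → Bool => (((Real.sqrt 2 : ℂ)⁻¹) ^ t) •
    basisState (fun w : Fin (t * 4) => b (finProdFinEquiv.symm w).1))).symm

/-- CALIBRATION at `t = 2` (two copies): the count admits `r ≤ 2` (`K = 2`: `2·29 < 64`) and no more
(`3·29 ≥ 64`; indeed NO Clifford flattening certifies `> 3` at `t = 2`, route-review pass 2), while
`4 = 2^2` Gaussian terms reach `M ⊗ M` exactly; the truth `χ_G(M⊗M) ∈ {3,4}` is crux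
`GaussRankTwoCopies` (Cudby–Strelchuk conjecture `= 4`). -/
theorem calibration_t2 :
    (2 * flatteningDeficiency 2 (2 * 4) < Nat.choose 2 2 * 8 ^ 2) ∧
    ¬ (3 * flatteningDeficiency 2 (2 * 4) < Nat.choose 2 2 * 8 ^ 2) ∧
    ∃ (a : Fin 4 → ℂ) (g : Fin 4 → QReg (2 * 4) → ℂ), (∀ i, IsGaussian (g i)) ∧
      magicMPow 2 = ∑ i, a i • g i :=
  ⟨by decide, by decide, magicMPow_eq_sum_two_pow 2⟩

/-- UPPER CONSISTENCY (a cheap-falsity test the crux PASSES): the crux forces the purely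
combinatorial inequality `C(t,K)·8^K ≤ 2^t · D_K(4t)` for all `t, K` (else the `2^t`-term exact
decomposition would violate `1 ≤ C(8t,K)·0`).  Checked directly for all `t ≤ 120` (integer
arithmetic, this seat) with equality only at `(t,K) = (0,0), (1,1)`; asymptotically the exponent gap is
`1 − max_κ [H(κ)+3κ−4H(κ/4)] = 1 − 0.3326`.  Had it failed anywhere, THAT `(t,K)` would refute the crux. -/
theorem flatteningBoundRobust_imp_count_le_two_pow (h : FlatteningBoundRobust) (t K : ℕ) :
    ¬ (2 ^ t * flatteningDeficiency K (t * 4) < t.choose K * 8 ^ K) := by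
  intro hlt
  rw [flatteningBoundRobust_iff] at h
  obtain ⟨a, g, hg, hdec⟩ := magicMPow_eq_sum_two_pow t
  have key := h t K (2 ^ t) hlt a g hg
  rw [← hdec, sub_self, normSq_zero', mul_zero] at key
  exact absurd key (by norm_num)

/-! ## §D Counterexample searches (numerics) — see the module docstring; job ids j000106, j007894. -/

/-! ## §E Targets (lead's stuck stubs): none registered yet (payload.stuck_stubs = []). -/

/-! ## §F By-products useful to the provers (positive helpers; travel as evidence, not as refutations) -/

/-- `C(t,K) · 8^K ≤ C(8t,K)`: the one-Majorana-per-block `K`-subsets inject into all `K`-subsets of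
the `8t` Majoranas (termwise `8(t−i) ≤ 8t−i` in the falling factorials).  This is the step from the
mass-bound form `1 ≤ C(t,K)8^K · normSq` (via the landed `stub_massBound`) to the crux's
`1 ≤ C(8t,K) · normSq`. -/
theorem choose_mul_eight_pow_le (t K : ℕ) : t.choose K * 8 ^ K ≤ (t * 8).choose K := by
  have h1 : t.descFactorial K * 8 ^ K ≤ (t * 8).descFactorial K := by
    rw [Nat.descFactorial_eq_prod_range, Nat.descFactorial_eq_prod_range, ← Finset.card_range K,
      ← Finset.prod_const, Finset.card_range, ← Finset.prod_mul_distrib]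
    apply Finset.prod_le_prod'
    intro i _
    rcases le_or_gt i t with h | h
    · have : (t - i) * 8 = t * 8 - i * 8 := Nat.sub_mul t i 8
      rw [this]
      apply Nat.sub_le_sub_left
      omega
    · rw [Nat.sub_eq_zero_of_le (Nat.le_of_lt h), zero_mul]
      exact Nat.zero_le _
  rw [Nat.choose_eq_descFactorial_div_factorial, Nat.choose_eq_descFactorial_div_factorial]
  calc t.descFactorial K / K.factorial * 8 ^ K
      = 8 ^ K * (t.descFactorial K / K.factorial) := mul_comm _ _
    _ ≤ 8 ^ K * t.descFactorial K / K.factorial := Nat.mul_div_le_mul_div_assoc _ _ _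
    _ = t.descFactorial K * 8 ^ K / K.factorial := by rw [mul_comm]
    _ ≤ (t * 8).descFactorial K / K.factorial := Nat.div_le_div_right h1

/-! ## §G Dictionary rigidity: the annihilators of ANY nonzero vector are isotropic, at most `n` of
them are independent — there is no "fake Gaussian" to serve as a counterexample. -/

/-- BILINEAR CAR: `c(v) c(w) + c(w) c(v) = 2 (v · w) 1` for linear combinations
`c(v) = Σ_p v_p c_p` of the Jordan–Wigner Majoranas. -/
theorem linComb_anticomm {n : ℕ} (v w : Fin n × Bool → ℂ) :
    (∑ p : Fin n × Bool, v p • majorana n p.1 p.2) * (∑ q : Fin n × Bool, w q • majorana n q.1 q.2) +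
      (∑ q : Fin n × Bool, w q • majorana n q.1 q.2) * (∑ p : Fin n × Bool, v p • majorana n p.1 p.2) =
      ((2 : ℂ) * ∑ p : Fin n × Bool, v p * w p) • (1 : Matrix (QReg n) (QReg n) ℂ) := by
  have h1 : (∑ p : Fin n × Bool, v p • majorana n p.1 p.2) * (∑ q : Fin n × Bool, w q • majorana n q.1 q.2) =
      ∑ p : Fin n × Bool, ∑ q : Fin n × Bool, (v p * w q) • (majorana n p.1 p.2 * majorana n q.1 q.2) := by
    rw [Finset.sum_mul]
    refine Finset.sum_congr rfl fun p _ => ?_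
    rw [Finset.mul_sum]
    refine Finset.sum_congr rfl fun q _ => ?_
    rw [Matrix.smul_mul, Matrix.mul_smul, smul_smul]
  have h2 : (∑ q : Fin n × Bool, w q • majorana n q.1 q.2) * (∑ p : Fin n × Bool, v p • majorana n p.1 p.2) =
      ∑ p : Fin n × Bool, ∑ q : Fin n × Bool, (v p * w q) • (majorana n q.1 q.2 * majorana n p.1 p.2) := by
    have h2' : (∑ q : Fin n × Bool, w q • majorana n q.1 q.2) * (∑ p : Fin n × Bool, v p • majorana n p.1 p.2) =
        ∑ q : Fin n × Bool, ∑ p : Fin n × Bool, (v p * w q) • (majorana n q.1 q.2 * majorana n p.1 p.2) := by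
      rw [Finset.sum_mul]
      refine Finset.sum_congr rfl fun q _ => ?_
      rw [Finset.mul_sum]
      refine Finset.sum_congr rfl fun p _ => ?_
      rw [Matrix.smul_mul, Matrix.mul_smul, smul_smul, mul_comm (w q) (v p)]
    rw [h2', Finset.sum_comm]
  rw [h1, h2, ← Finset.sum_add_distrib]
  simp_rw [← Finset.sum_add_distrib, ← smul_add, majorana_anticommutator]
  simp only [smul_ite, smul_zero, Finset.sum_ite_eq, Finset.mem_univ, if_true]
  rw [Finset.mul_sum, Finset.sum_smul]
  refine Finset.sum_congr rfl fun p _ => ?_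
  rw [smul_smul, mul_comm]

/-- ISOTROPY OF ANNIHILATORS: if `c(v) ψ = 0` and `c(w) ψ = 0` for some `ψ ≠ 0` then `v · w = 0`
(apply the bilinear CAR to `ψ`).  In particular the `n` annihilators of an `IsGaussian` witness span a
TOTALLY ISOTROPIC subspace of `ℂ^{2n}` — automatically, with no orbit description of Gaussian states. -/
theorem annihilators_orthogonal {n : ℕ} {ψ : QReg n → ℂ} (hψ : ψ ≠ 0) {v w : Fin n × Bool → ℂ}
    (hv : (∑ p : Fin n × Bool, v p • majorana n p.1 p.2) *ᵥ ψ = 0)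
    (hw : (∑ p : Fin n × Bool, w p • majorana n p.1 p.2) *ᵥ ψ = 0) :
    ∑ p : Fin n × Bool, v p * w p = 0 := by
  have key : ((∑ p : Fin n × Bool, v p • majorana n p.1 p.2) * (∑ q : Fin n × Bool, w q • majorana n q.1 q.2) +
      (∑ q : Fin n × Bool, w q • majorana n q.1 q.2) * (∑ p : Fin n × Bool, v p • majorana n p.1 p.2)) *ᵥ ψ =
      (((2 : ℂ) * ∑ p : Fin n × Bool, v p * w p) • (1 : Matrix (QReg n) (QReg n) ℂ)) *ᵥ ψ := by
    rw [linComb_anticomm]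
  rw [Matrix.add_mulVec, ← Matrix.mulVec_mulVec, ← Matrix.mulVec_mulVec, hw, hv, Matrix.mulVec_zero,
    Matrix.mulVec_zero, add_zero, Matrix.smul_mulVec, Matrix.one_mulVec] at key
  by_contra hne
  apply hψ
  have h2 : ((2 : ℂ) * ∑ p : Fin n × Bool, v p * w p) ≠ 0 := mul_ne_zero two_ne_zero hne
  have := congrArg (fun x => ((2 : ℂ) * ∑ p : Fin n × Bool, v p * w p)⁻¹ • x) key
  simp only [smul_zero, smul_smul, inv_mul_cancel₀ h2, one_smul] at this
  exact this.symm

/-- Every vector of an annihilating family is isotropic and any two are orthogonal for the bilinear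
form `v · w = Σ_p v_p w_p`: the Gram matrix of the family vanishes identically. -/
theorem annihilatorFamily_isotropic {n m : ℕ} {ψ : QReg n → ℂ} (hψ : ψ ≠ 0)
    (A : Fin m → (Fin n × Bool → ℂ))
    (hann : ∀ k, (∑ p : Fin n × Bool, A k p • majorana n p.1 p.2) *ᵥ ψ = 0) (k l : Fin m) :
    ∑ p : Fin n × Bool, A k p * A l p = 0 :=
  annihilators_orthogonal hψ (hann k) (hann l)

/-- MAXIMALITY: a nonzero vector on `n` qubits has at most `n` linearly independent annihilators among
the linear combinations of the `2n` Majoranas (an isotropic subspace of the non-degenerate symmetric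
form `v · w` on `ℂ^{2n}` has dimension `≤ n`).  So the `IsGaussian` dictionary cannot be gamed from
above: its annihilator space is exactly Lagrangian. -/
theorem card_annihilators_le {n m : ℕ} {ψ : QReg n → ℂ} (hψ : ψ ≠ 0)
    (A : Fin m → (Fin n × Bool → ℂ)) (hA : LinearIndependent ℂ A)
    (hann : ∀ k, (∑ p : Fin n × Bool, A k p • majorana n p.1 p.2) *ᵥ ψ = 0) : m ≤ n := by
  classical
  let B : LinearMap.BilinForm ℂ (Fin n × Bool → ℂ) := Matrix.toBilin' 1
  have hB : ∀ v w : Fin n × Bool → ℂ, B v w = ∑ p, v p * w p := by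
    intro v w
    show Matrix.toBilin' (1 : Matrix (Fin n × Bool) (Fin n × Bool) ℂ) v w = _
    rw [Matrix.toBilin'_apply', Matrix.one_mulVec]
    rfl
  have hrefl : B.IsRefl := by
    intro v w h
    rw [hB] at h ⊢
    rw [← h]
    exact Finset.sum_congr rfl fun p _ => mul_comm _ _
  have hker : LinearMap.ker B = ⊥ := by
    rw [Submodule.eq_bot_iff]
    intro v hv
    funext p
    have h := LinearMap.congr_fun (LinearMap.mem_ker.1 hv) (Pi.single p 1)
    rw [hB, LinearMap.zero_apply] at h
    have : ∑ q : Fin n × Bool, v q * (Pi.single p (1 : ℂ) : Fin n × Bool → ℂ) q = v p := by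
      rw [Finset.sum_eq_single p]
      · simp
      · intro q _ hq
        simp [hq]
      · simp
    rw [this] at h
    exact h
  let W : Submodule ℂ (Fin n × Bool → ℂ) := Submodule.span ℂ (Set.range A)
  have hW : Module.finrank ℂ W = m := by
    rw [finrank_span_eq_card hA, Fintype.card_fin]
  have hiso : W ≤ B.orthogonal W := by
    rw [Submodule.span_le]
    rintro _ ⟨k, rfl⟩
    rw [SetLike.mem_coe, LinearMap.BilinForm.mem_orthogonal_iff]
    intro w hw
    show B w (A k) = 0
    have hle : W ≤ LinearMap.ker (B (A k)) := by
      rw [Submodule.span_le]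
      rintro _ ⟨l, rfl⟩
      rw [SetLike.mem_coe, LinearMap.mem_ker, hB]
      exact annihilatorFamily_isotropic hψ A hann k l
    have h0 : B (A k) w = 0 := LinearMap.mem_ker.1 (hle hw)
    rw [hB] at h0 ⊢
    rw [← h0]
    exact Finset.sum_congr rfl fun p _ => mul_comm _ _
  have hdim := LinearMap.BilinForm.finrank_add_finrank_orthogonal hrefl W
  rw [LinearMap.BilinForm.orthogonal_top_eq_ker hrefl, hker, inf_bot_eq, finrank_bot, add_zero,
    Module.finrank_fintype_fun_eq_card, Fintype.card_prod, Fintype.card_fin, Fintype.card_bool,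
    hW] at hdim
  have hle : Module.finrank ℂ W ≤ Module.finrank ℂ (B.orthogonal W) := Submodule.finrank_mono hiso
  rw [hW] at hle
  omega

/-- Hence the dictionary with ONE MORE independent annihilator is EMPTY: no `ψ ≠ 0` on `n` qubits is
annihilated by `n + 1` linearly independent Majorana combinations.  (Had the crux been typed with
`Fin (n+1)` — or `2n` — annihilators, it would be VACUOUSLY true; with `Fin n` it is the genuine
pure-spinor dictionary.) -/
theorem no_overcomplete_annihilators (n : ℕ) :
    ¬ ∃ ψ : QReg n → ℂ, ψ ≠ 0 ∧ ∃ A : Fin (n + 1) → (Fin n × Bool → ℂ), LinearIndependent ℂ A ∧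
      ∀ k, (∑ p : Fin n × Bool, A k p • majorana n p.1 p.2) *ᵥ ψ = 0 := by
  rintro ⟨ψ, hψ, A, hA, hann⟩
  have := card_annihilators_le hψ A hA hann
  omega

/-- For an `IsGaussian` state the annihilator family of any witness is isotropic (packaged form). -/
theorem IsGaussian.witness_isotropic {n : ℕ} {ψ : QReg n → ℂ} (hψ : ψ ≠ 0)
    {A : Fin n → (Fin n × Bool → ℂ)}
    (hann : ∀ k, (∑ p : Fin n × Bool, A k p • majorana n p.1 p.2) *ᵥ ψ = 0) :
    ∀ k l, ∑ p : Fin n × Bool, A k p * A l p = 0 :=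
  fun k l => annihilatorFamily_isotropic hψ A hann k l


/-! ## §H Tightness of the constant `1` at EVERY `t` (generation 2) -/

/-- Superpositions of DISTINCT basis states are isometric to their coefficient vectors:
`normSq (Σᵢ aᵢ |f i⟩) = Σᵢ ‖aᵢ‖²` for injective `f`. -/
theorem normSq_sum_smul_basisState_inj {N : ℕ} {ι : Type*} [Fintype ι] {f : ι → QReg N}
    (hf : Function.Injective f) (a : ι → ℂ) :
    normSq (∑ i, a i • basisState (f i)) = ∑ i, ‖a i‖ ^ 2 := by
  classical
  unfold normSq
  have happ : ∀ z : QReg N, (∑ i, a i • basisState (f i)) z =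
      if h : z ∈ Set.range f then a h.choose else 0 := by
    intro z
    rw [Finset.sum_apply]
    simp only [Pi.smul_apply, basisState_apply, smul_eq_mul, mul_ite, mul_one, mul_zero]
    split_ifs with h
    · have hspec := h.choose_spec
      rw [Finset.sum_eq_single h.choose]
      · rw [if_pos hspec.symm]
      · intro i _ hi
        rw [if_neg]
        intro e
        apply hi
        exact hf (by rw [← e, hspec])
      · simp
    · exact Finset.sum_eq_zero fun i _ => if_neg fun e => h ⟨i, e.symm⟩
  simp_rw [happ]
  rw [← Finset.sum_filter_add_sum_filter_not univ (fun z => z ∈ Set.range f)]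
  have hzero : ∑ z ∈ univ.filter (fun z => z ∉ Set.range f),
      ‖(if h : z ∈ Set.range f then a h.choose else 0)‖ ^ 2 = 0 :=
    Finset.sum_eq_zero fun z hz => by
      rw [mem_filter] at hz
      rw [dif_neg hz.2]
      simp
  rw [hzero, add_zero]
  have himg : univ.filter (fun z => z ∈ Set.range f) = univ.image f := by
    ext z
    simp [Set.mem_range, eq_comm]
  rw [himg, Finset.sum_image fun i _ j _ h => hf h]
  refine Finset.sum_congr rfl fun i _ => ?_
  have hi : f i ∈ Set.range f := ⟨i, rfl⟩
  rw [dif_pos hi, hf hi.choose_spec]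

/-- The block strings `b ↦ (w ↦ b ⌊w/4⌋)` are pairwise distinct. -/
theorem blockString_injective (t : ℕ) :
    Function.Injective (fun b : Fin t → Bool => (fun w : Fin (t * 4) => b (finProdFinEquiv.symm w).1)) := by
  intro b b' h
  funext k
  have := congrFun h (finProdFinEquiv (k, (0 : Fin 4)))
  simpa using this

/-- `|M⟩^{⊗t}` is a unit vector: `normSq (magicMPow t) = 1` (from the `2^t` block strings of
amplitude `(√2)^{-t}`). -/
theorem normSq_magicMPow (t : ℕ) : normSq (magicMPow t) = 1 := by
  rw [magicMPow_eq_sum_blockStrings, normSq_sum_smul_basisState_inj (blockString_injective t),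
    Finset.sum_const, Finset.card_univ, Fintype.card_fun, Fintype.card_bool, Fintype.card_fin,
    nsmul_eq_mul, norm_pow, ← pow_mul, mul_comm t 2, pow_mul, norm_inv_sqrt_two_sq, Nat.cast_pow,
    Nat.cast_ofNat, ← mul_pow]
  norm_num

/-- TIGHTNESS AT EVERY `t`: at `(t, K, r) = (t, 0, 0)` the count holds (`0 < 1`) and the conclusion
of the crux holds with EQUALITY, `C(8t,0) · normSq (M^{⊗t} − 0) = 1` — the constant `1` on the left of
`1 ≤ C(8t,K) · normSq (…)` cannot be improved for any number of copies (generation 1 had `t = 1`). -/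
theorem flatteningBoundRobust_tight_K0 (t : ℕ) :
    0 * flatteningDeficiency 0 (t * 4) < t.choose 0 * 8 ^ 0 ∧
    ∀ (a : Fin 0 → ℂ) (g : Fin 0 → QReg (t * 4) → ℂ),
      ((t * 8).choose 0 : ℝ) * normSq (magicMPow t - ∑ i, a i • g i) = 1 := by
  refine ⟨by simp, fun a g => ?_⟩
  rw [Finset.univ_eq_empty, Finset.sum_empty, sub_zero, normSq_magicMPow]
  simp

/-- … and for `K ≥ 1` (still `r = 0`, count `0 < C(t,K)·8^K` whenever `K ≤ t`) the conclusion holds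
with room `C(8t,K) ≥ 8`: the `r = 0` slice of the crux is TRUE outright at every `t` (so a
counterexample needs `r ≥ 1`, where the count forces `K ≥ 1` and Gaussianity enters). -/
theorem robust_slice_r0 (t K : ℕ) (a : Fin 0 → ℂ) (g : Fin 0 → QReg (t * 4) → ℂ)
    (hK : K ≤ t * 8) :
    (1 : ℝ) ≤ ((t * 8).choose K : ℝ) * normSq (magicMPow t - ∑ i, a i • g i) := by
  rw [Finset.univ_eq_empty, Finset.sum_empty, sub_zero, normSq_magicMPow, mul_one]
  exact_mod_cast Nat.choose_pos hK

/-! ## §A (continued, generation 2): the deficiency constant cannot be lowered by one -/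

/-- The crux with the deficiency `D_K(4t)` replaced by `D_K(4t) − 1`. -/
def WithDeficiencyPred : Prop :=
  ∀ t K r : ℕ, r * (flatteningDeficiency K (t * 4) - 1) < t.choose K * 8 ^ K →
    ∀ (a : Fin r → ℂ) (g : Fin r → QReg (t * 4) → ℂ), (∀ i, IsGaussian (g i)) →
      (1 : ℝ) ≤ ((t * 8).choose K : ℝ) * normSq (magicMPow t - ∑ i, a i • g i)

/-- The deficiency count `D_K(N)` is SHARP as a constant: lowering it by one admits `(t,K,r) = (1,1,2)`
(`2 · (4 − 1) = 6 < 8`), where the exact 2-term decomposition of `|M⟩` has residual `0`.  (Consistent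
with kit j000106: rank F_K(g) = D_K(4t) exactly for generic Gaussian `g`.) -/
theorem flatteningBoundRobust_false_with_deficiency_pred : ¬ WithDeficiencyPred := by
  intro h
  have hcount : 2 * (flatteningDeficiency 1 (1 * 4) - 1) < Nat.choose 1 1 * 8 ^ 1 := by decide
  have key := h 1 1 2 hcount aW gW gW_isGaussian
  rw [sum_aW_gW, sub_self, normSq_zero', mul_zero] at key
  exact absurd key (by norm_num)

/-! ## §J How many annihilators are load-bearing?  `n − 4` do NOT suffice (t = 2, four per term) -/

/-- THE ONE-MODE ANNIHILATOR OF A BASIS STATE: `(c_{k,X} + i (−1)^{x_k} c_{k,Y}) |x⟩ = 0`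
(`= 2 a_k` on an empty mode, `2 a_k†` on a full one).  Extracted from `basisState_isGaussian` as a
reusable lemma. -/
theorem modeAnnihilator_basisState {n : ℕ} (x : QReg n) (k : Fin n) :
    (majorana n k false + (if x k then -Complex.I else Complex.I) • majorana n k true) *ᵥ
      basisState x = 0 := by
  rw [Matrix.add_mulVec, Matrix.smul_mulVec]
  funext y
  simp only [Pi.add_apply, Pi.smul_apply, Pi.zero_apply, smul_eq_mul, basisState,
    Matrix.mulVec_single_one, Matrix.col_apply, majorana_apply]
  cases x k <;> cases y k <;> simp <;> ring_nf <;> simp [Complex.I_sq]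

/-- The block string of a pattern `b : Fin t → Bool` (constant `b k` on block `k`). -/
def bs {t : ℕ} (b : Fin t → Bool) : QReg (t * 4) := fun w => b (finProdFinEquiv.symm w).1

/-- The partially Gaussian witnesses on `2 · 4` qubits: `ψ_c = (√2)⁻¹ (|c⁴ 0⁴⟩ + |c⁴ 1⁴⟩) = |c c c c⟩ ⊗ |M⟩`
— Gaussian (a basis state) on block 0, the magic state on block 1. -/
def psiW (c : Bool) : QReg (2 * 4) → ℂ :=
  (Real.sqrt 2 : ℂ)⁻¹ • (basisState (bs ![c, false]) + basisState (bs ![c, true]))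

/-- The four annihilators of `ψ_c`: the one-mode annihilators of the wires of block 0. -/
def annW (c : Bool) : Fin 4 → (Fin (2 * 4) × Bool → ℂ) := fun k p =>
  if p.1 = finProdFinEquiv ((0 : Fin 2), k) then (if p.2 then (if c then -Complex.I else Complex.I) else 1)
  else 0

theorem annW_linearIndependent (c : Bool) : LinearIndependent ℂ (annW c) := by
  rw [Fintype.linearIndependent_iff]
  intro g hg k
  have h := congrFun hg (finProdFinEquiv ((0 : Fin 2), k), false)
  simp only [Finset.sum_apply, Pi.smul_apply, smul_eq_mul, Pi.zero_apply, annW] at h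
  rw [Finset.sum_eq_single k] at h
  · simpa using h
  · intro k' _ hk'
    rw [if_neg, mul_zero]
    intro e
    exact hk' (Prod.mk.inj (finProdFinEquiv.injective e)).2.symm
  · simp

theorem annW_sum (c : Bool) (k : Fin 4) :
    (∑ p : Fin (2 * 4) × Bool, annW c k p • majorana (2 * 4) p.1 p.2) =
      majorana (2 * 4) (finProdFinEquiv ((0 : Fin 2), k)) false +
        (if c then -Complex.I else Complex.I) • majorana (2 * 4) (finProdFinEquiv ((0 : Fin 2), k)) true := by
  rw [Fintype.sum_prod_type, Finset.sum_eq_single (finProdFinEquiv ((0 : Fin 2), k))]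
  · simp [annW, add_comm]
  · intro j _ hj
    simp [annW, hj]
  · simp

theorem bs_block0 (c d : Bool) (k : Fin 4) :
    bs ![c, d] (finProdFinEquiv ((0 : Fin 2), k)) = c := by
  simp [bs]

theorem annW_annihilates (c : Bool) (k : Fin 4) :
    (∑ p : Fin (2 * 4) × Bool, annW c k p • majorana (2 * 4) p.1 p.2) *ᵥ psiW c = 0 := by
  rw [annW_sum, psiW, Matrix.mulVec_smul, Matrix.mulVec_add]
  have h1 := modeAnnihilator_basisState (bs ![c, false]) (finProdFinEquiv ((0 : Fin 2), k))
  have h2 := modeAnnihilator_basisState (bs ![c, true]) (finProdFinEquiv ((0 : Fin 2), k))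
  rw [bs_block0] at h1 h2
  rw [h1, h2, add_zero, smul_zero]

theorem psiW_ne_zero (c : Bool) : psiW c ≠ 0 := by
  intro h
  have := congrFun h (bs ![c, false])
  have hne : bs ![c, false] ≠ bs ![c, true] := by
    intro e
    have := congrFun e (finProdFinEquiv ((1 : Fin 2), (0 : Fin 4)))
    simp [bs] at this
  norm_num [psiW, hne] at this

/-- `|M⟩^{⊗t} = (√2)^{-t} Σ_{b : Fin t → Bool} |b₀⁴ b₁⁴ ⋯⟩` (block strings, phrased with `bs`). -/
theorem magicMPow_blockStrings' (t : ℕ) :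
    magicMPow t = ∑ b : Fin t → Bool, (((Real.sqrt 2 : ℂ)⁻¹) ^ t) • basisState (bs b) := by
  classical
  funext x
  simp only [Finset.sum_apply, Pi.smul_apply, basisState_apply, smul_eq_mul, mul_ite, mul_one,
    mul_zero]
  by_cases hP : ∀ k : Fin t, ∀ i : Fin 4,
      x (finProdFinEquiv (k, i)) = x (finProdFinEquiv (k, (0 : Fin 4)))
  · rw [magicMPow_apply, if_pos hP]
    rw [Finset.sum_eq_single (fun k => x (finProdFinEquiv (k, (0 : Fin 4))))]
    · rw [if_pos]
      funext w
      obtain ⟨⟨k, i⟩, rfl⟩ := finProdFinEquiv.surjective w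
      simp only [bs, Equiv.symm_apply_apply]
      exact hP k i
    · intro b _ hb
      rw [if_neg]
      intro hx
      apply hb
      funext k
      have := congrFun hx (finProdFinEquiv (k, (0 : Fin 4)))
      simp only [bs, Equiv.symm_apply_apply] at this
      exact this.symm
    · intro h
      exact absurd (Finset.mem_univ _) h
  · rw [magicMPow_apply, if_neg hP]
    symm
    apply Finset.sum_eq_zero
    intro b _
    rw [if_neg]
    intro hx
    apply hP
    intro k i
    rw [hx]
    simp only [bs, Equiv.symm_apply_apply]

/-- `|M⟩ ⊗ |M⟩ = (√2)⁻¹ ψ_false + (√2)⁻¹ ψ_true` — a 2-term combination of the partially Gaussian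
witnesses, in the crux's own shape. -/
theorem magicMPow_two_eq :
    magicMPow 2 = ∑ i : Fin 2, (![(Real.sqrt 2 : ℂ)⁻¹, (Real.sqrt 2 : ℂ)⁻¹] i) • (![psiW false, psiW true] i) := by
  rw [magicMPow_blockStrings', Fin.sum_univ_two]
  simp only [Matrix.cons_val_zero, Matrix.cons_val_one]
  rw [← Equiv.sum_comp (finTwoArrowEquiv Bool).symm, Fintype.sum_prod_type, Fintype.sum_bool,
    Fintype.sum_bool, Fintype.sum_bool]
  simp only [finTwoArrowEquiv_symm_apply, psiW, smul_add, smul_smul, pow_two]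
  abel

/-- The dictionary with FOUR FEWER annihilators: `ψ ≠ 0` annihilated by `n − 4` independent Majorana
combinations (e.g. a Gaussian state on all but one block, tensored with ANYTHING on that block). -/
def IsSubGaussian4 {n : ℕ} (ψ : QReg n → ℂ) : Prop :=
  ψ ≠ 0 ∧ ∃ A : Fin (n - 4) → (Fin n × Bool → ℂ), LinearIndependent ℂ A ∧
    ∀ k, (∑ p : Fin n × Bool, A k p • majorana n p.1 p.2) *ᵥ ψ = 0

/-- The witnesses are in the weakened dictionary (`n − 4 = 4` annihilators on `8` qubits). -/
theorem psiW_isSubGaussian4 (c : Bool) : IsSubGaussian4 (psiW c) :=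
  ⟨psiW_ne_zero c, annW c, annW_linearIndependent c, annW_annihilates c⟩

/-- The crux over the dictionary with `n − 4` annihilators (count unchanged). -/
def WithFourFewerAnnihilators : Prop :=
  ∀ t K r : ℕ, r * flatteningDeficiency K (t * 4) < t.choose K * 8 ^ K →
    ∀ (a : Fin r → ℂ) (g : Fin r → QReg (t * 4) → ℂ), (∀ i, IsSubGaussian4 (g i)) →
      (1 : ℝ) ≤ ((t * 8).choose K : ℝ) * normSq (magicMPow t - ∑ i, a i • g i)

/-- HOW MANY ANNIHILATORS ARE LOAD-BEARING: with `n − 4` of the `n = 4t` annihilators the crux is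
FALSE at `(t,K,r) = (2,2,2)` (count `2 · 29 = 58 < 64`): `|M⟩⊗|M⟩ = (√2)⁻¹(ψ_false + ψ_true)` with
`ψ_c = |c c c c⟩ ⊗ |M⟩` annihilated by the four one-mode annihilators of block 0.  (With `t = 1` this is
just "drop Gaussianity"; here every term still carries `m = 4 > 0` independent annihilators.)  So the
deficiency step must use MORE than `n − 4` annihilators per term; informally `n − 3` suffice modulo the
crux itself, since the even and odd parts of an `(n−k)`-annihilated vector are Gaussian for `k ≤ 3`
(all half-spinors in `≤ 3` modes are pure) — recorded, not formalised. -/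
theorem flatteningBoundRobust_false_with_four_fewer_annihilators : ¬ WithFourFewerAnnihilators := by
  intro h
  have hcount : 2 * flatteningDeficiency 2 (2 * 4) < Nat.choose 2 2 * 8 ^ 2 := by decide
  have hg : ∀ i, IsSubGaussian4 ((![psiW false, psiW true] : Fin 2 → QReg (2 * 4) → ℂ) i) := by
    intro i
    fin_cases i
    · exact psiW_isSubGaussian4 false
    · exact psiW_isSubGaussian4 true
  have key := h 2 2 2 hcount ![(Real.sqrt 2 : ℂ)⁻¹, (Real.sqrt 2 : ℂ)⁻¹] ![psiW false, psiW true] hg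
  rw [← magicMPow_two_eq, sub_self] at key
  norm_num [normSq] at key


end Summit.QuantumAdvantage.QuantumAdvantage.Cruxes.FlatteningBoundRobust.Disproof
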